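import Summits.NavierStokesRegularity.NavierStokesRegularity.Theorems.QuantisedSymmetryPolyhedralDssProfileExistsStubZoomLimitIsTrace
import HarnessLib

/-!
# Along the DSS lattice the far field of every slice is the blow-up trace — crux
  stmt-NavierStokesRegularity-1404 (`QuantisedSymmetry.PolyhedralDssProfileExists`), line
  polyhedral_cell, stub stub_farFieldIsTrace (N34)

Registered stub `stub_farFieldIsTrace` (`--supports stmt-NavierStokesRegularity-1404`). Let `V` be
exactly `c`-DSS (`c > 1`) and let `V₀` be the POINTWISE blow-up-time trace of the slices away from
the origin: `V t x → V₀ x` as `t ↑ 0` for every `x ≠ 0`. Then for every `t < 0` and every `x ≠ 0`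
the zooms of the slice `V t` along the DSS scales `λ = cᵏ` converge at `x` to the trace:
`cᵏ • V t (cᵏ • x) → V₀ x` as `k → ∞`. This is the pointwise companion of N27
(`stub_zoomLimitIsTrace`, weak version).

Proof sketch. The zoom identity `cᵏ • V t (cᵏ • x) = V (t / (cᵏ)²) x`
(`zoomLimitIsTrace_zoom_eq`, from iterating `nsRescale c V = V`; needs only `c ≠ 0`) says the
`k`-th zoom at `x` IS the slice at the earlier time `t / (cᵏ)²` evaluated at the same `x`. Since
`c > 1` and `t < 0`, `t / (cᵏ)² → 0` within `Iio 0` (`zoomLimitIsTrace_tendsto_time`). Compose the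
pointwise convergence hypothesis at `x` with this sequence of times (`Filter.Tendsto.comp`) and
rewrite termwise (`Filter.Tendsto.congr`).
-/

noncomputable section

-- the summit namespace `…NavierStokesRegularity.NavierStokesRegularity…` is the tree convention (D-0017)
set_option linter.dupNamespace false

namespace Summit.NavierStokesRegularity.NavierStokesRegularity.Theorems.PolyhedralDssProfileExists.PolyhedralCell

open MeasureTheory Set Function Filter Topology
open Literature.Analysis Literature.Analysis.FluidPDE
open scoped InnerProductSpace RealInnerProductSpace

/-! ### The registered stub -/

/-- **REGISTERED STUB `stub_farFieldIsTrace` (N34): along the DSS lattice, the far field of EVERY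
slice is the blow-up trace, pointwise.** Let `V` be exactly `c`-DSS (`c > 1`) and let `V₀` satisfy
`V t x → V₀ x` as `t ↑ 0` for every `x ≠ 0`. Then for every `t < 0` and every `x ≠ 0`,
`cᵏ • V t (cᵏ • x) → V₀ x` as `k → ∞`. Proof: by the zoom identity
`cᵏ • V t (cᵏ • x) = V (t / (cᵏ)²) x` (`zoomLimitIsTrace_zoom_eq`) the `k`-th zoom at `x` is the
slice at time `t / (cᵏ)²` at `x`, and these times tend to `0⁻` (`zoomLimitIsTrace_tendsto_time`);
compose with the pointwise convergence at `x`. [folklore] -/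
theorem stub_farFieldIsTrace :
    ∀ (V : ℝ → EuclideanSpace ℝ (Fin 3) → EuclideanSpace ℝ (Fin 3)) (c : ℝ)
      (V₀ : EuclideanSpace ℝ (Fin 3) → EuclideanSpace ℝ (Fin 3)),
      1 < c → IsDiscretelySelfSimilar c V →
      (∀ x, x ≠ 0 → Tendsto (fun t => V t x) (𝓝[<] 0) (𝓝 (V₀ x))) →
      ∀ t < 0, ∀ x, x ≠ 0 → Tendsto (fun k : ℕ => (c ^ k) • V t ((c ^ k) • x)) atTop (𝓝 (V₀ x)) := by
  intro V c V₀ hc hdss hlim t ht x hx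
  have hc0 : c ≠ 0 := (one_pos.trans hc).ne'
  refine Tendsto.congr (fun k => ?_) ((hlim x hx).comp (zoomLimitIsTrace_tendsto_time hc ht))
  simp only [Function.comp_apply, zoomLimitIsTrace_zoom_eq hc0 hdss]

end Summit.NavierStokesRegularity.NavierStokesRegularity.Theorems.PolyhedralDssProfileExists.PolyhedralCell

end
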